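import Summits.MatrixMultiplication.MatrixMultiplication.Theorems.ObstructionDescentEmptyLevelFormat
import Summits.MatrixMultiplication.MatrixMultiplication.Theorems.ObstructionDescentPropagatedParity

set_option linter.dupNamespace false

/-!
# Obstruction descent, part M — level 3 is empty at format 2; the pair law H19 at level 3 is unconditional

`route-MatrixMultiplication-ObstructionDescent`, aside `InvariantSaturation` (stmt 32282); decomp-mm lens-3, NODE-g15.

Part K proved the pair law H19 under the Kronecker vacuity `3 ∈ emptyLevels m 2`, and part L reduced that input to the
single fixed statement `3 ∈ emptyLevels 2 2`: there is no non-zero `B₂³`-semi-invariant sextic of weight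
`((3,3),(3,3),(3,3))` in the `8` coordinates of `ℂ² ⊗ ℂ² ⊗ ℂ²` (`g((3,3),(3,3),(3,3)) = 0`; classically: the invariants
of `SL₂³` on `ℂ²⊗ℂ²⊗ℂ²` are `ℂ[Δ]` with `deg Δ = 4`).  This file PROVES it (`three_mem_emptyLevels_two_two`) by four
evaluations and no representation theory:

* **Two monomials (`evalT_family_two`).**  On the five-cell family `T(p,x,y,z) = e₁₁₁ + p e₀₀₀ + x e₁₀₀ + y e₀₁₀ + z e₀₀₁`
  the slice sums of the exponents (part I) leave exactly two monomials, `x₀₀₀³x₁₁₁³` and `x₀₀₀x₁₀₀x₀₁₀x₀₀₁x₁₁₁²`: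
  `f(T(p,x,y,z)) = c_A p³ + c_B pxyz`.
* **`c_A = 0`** — `T(1,0,0,0)` is the GHZ tensor, fixed by the odd corner permutation `(swap, swap, swap)`, on which
  every odd-level vector vanishes (H12 (C), `evalT_eq_zero_of_oddSymmetry`).
* **`c_B = 0`** — `U = T(1,1,1,1)` has `f(U) = c_B`; its image `V` under `(swap,swap,swap)` has `f(V) = -f(U)` (H12 (B′));
  and three unipotent shears (slot-wise `x₀ ↦ x₀ - x₁`, Borel with trivial character) carry `V` to `T(3,-1,-1,-1)`, where
  `f = 27 c_A - 3 c_B`.  Hence `-c_B = -3 c_B`.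
* **Every tensor** with `t₁₁₁ ≠ 0` is carried INTO the family by an explicit Borel triple (Gaussian elimination of the
  three cells `011, 101, 110`), so `f(t) = 0` by semi-invariance; a tensor with `t₁₁₁ = 0` lies on the line
  `t + u e₁₁₁`, on which `f` is a polynomial in `u` vanishing for all `u ≠ -t₁₁₁`, hence at `u = 0`.

CONSEQUENCES (with parts K, L): at EVERY format `m ≥ 2`, every level-`3` weight vector of the full type `((3^m))³`
vanishes on all tensors of rank `≤ r` whenever `2r + 1 < 3m` (`evalT_eq_zero_of_level_three`), i.e.
`3 ∉ E′_m(t)` for `R(t) ≤ r` (`three_not_mem_pointLevels`): `r_m(3) ≥ ⌈(3m-1)/2⌉` unconditionally — no level-3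
representation-theoretic obstruction of the full format separates a tensor of rank `< (3m-1)/2` from the
unit tensor.  By format independence (part L) `3 ∈ emptyLevels m 2` for all `m ≥ 2` (`three_mem_emptyLevels_two`).

[cite: BurgisserIkenmeyer2011, §3.1–3.2 and §6.2] (weight vectors; Strassen's invariant is the first level-3 vector,
format 3), [cite: BurgisserIkenmeyer2017, §5 (5.2), Thm 5.3], [cite: LandsbergGCT2017, §8.3.4].
-/

noncomputable section

open scoped BigOperators
open Finset

namespace Summit.MatrixMultiplication.MatrixMultiplication.Theorems.ObstructionCalculus

open Literature.Computability.AlgebraicComplexity (actTensor actTensor_apply actTensor_permMatrix_apply tensorRank)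

section LevelThreeFormatTwo

/-- **The five-cell family carries two monomials.**  For a weight vector `f` of type `((3,3),(3,3),(3,3))`, degree `6`,
on `ℂ²⊗ℂ²⊗ℂ²`: `f(e₁₁₁ + p e₀₀₀ + x e₁₀₀ + y e₀₁₀ + z e₀₀₁) = c_A p³ + c_B pxyz` with `c_A, c_B` the coefficients of
`x₀₀₀³x₁₁₁³` and `x₀₀₀x₁₀₀x₀₁₀x₀₀₁x₁₁₁²`. [this node] -/
theorem evalT_family_two {f : MvPolynomial (Idx 2) ℂ} (hf : f ∈ hwvSpace (rectType 2 2 3) (3 * 2)) (p x y z : ℂ) :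
    evalT (fun a b c => ![![![p, z], ![y, 0]], ![![x, 0], ![0, 1]]] a b c) f =
      f.coeff (Finsupp.single (0, 0, 0) 3 + Finsupp.single (1, 1, 1) 3) * p ^ 3 +
        f.coeff (Finsupp.single (0, 0, 0) 1 + Finsupp.single (1, 0, 0) 1 + Finsupp.single (0, 1, 0) 1 +
          Finsupp.single (0, 0, 1) 1 + Finsupp.single (1, 1, 1) 2) * (p * x * y * z) := by
  classical
  set μA : Idx 2 →₀ ℕ := Finsupp.single (0, 0, 0) 3 + Finsupp.single (1, 1, 1) 3 with hμA
  set μB : Idx 2 →₀ ℕ := Finsupp.single (0, 0, 0) 1 + Finsupp.single (1, 0, 0) 1 + Finsupp.single (0, 1, 0) 1 +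
    Finsupp.single (0, 0, 1) 1 + Finsupp.single (1, 1, 1) 2 with hμB
  have hAv : ∀ q : Idx 2, μA q = ![![![3, 0], ![0, 0]], ![![0, 0], ![0, 3]]] q.1 q.2.1 q.2.2 := by
    rintro ⟨a, b, c⟩
    fin_cases a <;> fin_cases b <;> fin_cases c <;> simp [hμA]
  have hBv : ∀ q : Idx 2, μB q = ![![![1, 1], ![1, 0]], ![![1, 0], ![0, 2]]] q.1 q.2.1 q.2.2 := by
    rintro ⟨a, b, c⟩
    fin_cases a <;> fin_cases b <;> fin_cases c <;> simp [hμB]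
  have hAB : μA ≠ μB := fun h => by have h' := congrArg (fun ν => ν (0, 0, 0)) h; simp [hAv, hBv] at h'
  -- (1) classification of the monomials supported on the five cells
  have hcls : ∀ μ ∈ f.support, μ (0, 1, 1) = 0 → μ (1, 0, 1) = 0 → μ (1, 1, 0) = 0 → μ = μA ∨ μ = μB := by
    intro μ hμ h011 h101 h110
    have hext : ∀ (P : Idx 2 → Prop) [DecidablePred P],
        (∑ q ∈ μ.support.filter P, μ q) = ∑ q ∈ (Finset.univ : Finset (Idx 2)).filter P, μ q := by
      intro P _
      apply Finset.sum_subset (Finset.filter_subset_filter P (Finset.subset_univ _))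
      intro q hq hq'
      rw [Finset.mem_filter] at hq hq'
      exact Finsupp.notMem_support_iff.mp fun h => hq' ⟨h, hq.2⟩
    obtain ⟨h00, h10, h20⟩ := sliceSum_eq_of_mem_support hf hμ 0
    obtain ⟨h01, h11, h21⟩ := sliceSum_eq_of_mem_support hf hμ 1
    rw [hext, rectType_self_apply] at h00 h10 h20 h01 h11 h21
    simp only [Finset.sum_filter, Fintype.sum_prod_type, Fin.sum_univ_two, Fin.isValue, if_true,
      Fin.zero_eq_one_iff, OfNat.ofNat_ne_one, one_ne_zero, if_false, add_zero,
      zero_add] at h00 h10 h20 h01 h11 h21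
    have hv : (μ (0, 0, 0) = 3 ∧ μ (1, 1, 1) = 3 ∧ μ (1, 0, 0) = 0 ∧ μ (0, 1, 0) = 0 ∧ μ (0, 0, 1) = 0) ∨
        (μ (0, 0, 0) = 1 ∧ μ (1, 1, 1) = 2 ∧ μ (1, 0, 0) = 1 ∧ μ (0, 1, 0) = 1 ∧ μ (0, 0, 1) = 1) := by omega
    rcases hv with h | h
    · left
      ext ⟨a, b, c⟩
      rw [hAv]
      fin_cases a <;> fin_cases b <;> fin_cases c <;> simp [h, h011, h101, h110]
    · right
      ext ⟨a, b, c⟩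
      rw [hBv]
      fin_cases a <;> fin_cases b <;> fin_cases c <;> simp [h, h011, h101, h110]
  -- (2) expansion of the evaluation
  rw [evalT, MvPolynomial.aeval_eq_eval, MvPolynomial.eval_eq']
  have hterm : ∀ μ ∈ f.support,
      f.coeff μ * ∏ q : Idx 2, (fun q : Idx 2 => ![![![p, z], ![y, 0]], ![![x, 0], ![0, 1]]] q.1 q.2.1 q.2.2) q ^ μ q =
        (if μ = μA then f.coeff μ * p ^ 3 else 0) + (if μ = μB then f.coeff μ * (p * x * y * z) else 0) := by
    intro μ hμ
    by_cases h0 : μ (0, 1, 1) = 0 ∧ μ (1, 0, 1) = 0 ∧ μ (1, 1, 0) = 0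
    · rcases hcls μ hμ h0.1 h0.2.1 h0.2.2 with rfl | rfl
      · rw [if_pos rfl, if_neg hAB, add_zero]
        congr 1
        simp only [Fintype.prod_prod_type, Fin.prod_univ_two, hAv]
        simp
      · rw [if_neg hAB.symm, if_pos rfl, zero_add]
        congr 1
        simp only [Fintype.prod_prod_type, Fin.prod_univ_two, hBv]
        simp
        ring
    · have hne : ∀ ν : Idx 2 →₀ ℕ, ν (0, 1, 1) = 0 → ν (1, 0, 1) = 0 → ν (1, 1, 0) = 0 → μ ≠ ν := by
        intro ν h1 h2 h3 h
        subst h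
        exact h0 ⟨h1, h2, h3⟩
      rw [if_neg (hne μA (by simp [hAv]) (by simp [hAv]) (by simp [hAv])),
        if_neg (hne μB (by simp [hBv]) (by simp [hBv]) (by simp [hBv])), add_zero]
      apply mul_eq_zero_of_right
      simp only [not_and_or] at h0
      rcases h0 with h | h | h
      · exact Finset.prod_eq_zero (Finset.mem_univ ((0 : Fin 2), (1 : Fin 2), (1 : Fin 2)))
          (by simp [zero_pow h])
      · exact Finset.prod_eq_zero (Finset.mem_univ ((1 : Fin 2), (0 : Fin 2), (1 : Fin 2)))
          (by simp [zero_pow h])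
      · exact Finset.prod_eq_zero (Finset.mem_univ ((1 : Fin 2), (1 : Fin 2), (0 : Fin 2)))
          (by simp [zero_pow h])
  rw [Finset.sum_congr rfl hterm, Finset.sum_add_distrib, Finset.sum_ite_eq', Finset.sum_ite_eq']
  by_cases hA : μA ∈ f.support <;> by_cases hB : μB ∈ f.support <;>
    simp only [hA, hB, if_true, if_false, MvPolynomial.notMem_support_iff.mp, zero_mul, add_zero, zero_add,
      not_false_eq_true]

/-- **`3 ∈ emptyLevels 2 2`: there is no level-3 weight vector on `ℂ² ⊗ ℂ² ⊗ ℂ²`** (`g((3,3),(3,3),(3,3)) = 0`).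
[this node] -/
theorem three_mem_emptyLevels_two_two : 3 ∈ emptyLevels 2 2 := by
  classical
  show hwvSpace (rectType 2 2 3) (3 * 2) = ⊥
  rw [Submodule.eq_bot_iff]
  intro f hf
  set σ : Equiv.Perm (Fin 2) := Equiv.swap 0 1 with hσ
  have hσm : ∀ a : Fin 2, σ a ≠ a → 2 ≤ (a : ℕ) + 2 := fun a _ => by omega
  have hsign : Equiv.Perm.sign σ = -1 := Equiv.Perm.sign_swap (by decide)
  have hodd : Odd 3 := by decide
  -- the two coefficients
  have hA : f.coeff (Finsupp.single (0, 0, 0) 3 + Finsupp.single (1, 1, 1) 3) = 0 := by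
    have h := evalT_family_two hf 1 0 0 0
    rw [evalT_eq_zero_of_oddSymmetry hodd hf σ hσm hsign, eq_comm] at h
    · simpa using h
    · funext a b c
      rw [actTensor_permMatrix_apply]
      fin_cases a <;> fin_cases b <;> fin_cases c <;> simp [hσ]
  have hB : f.coeff (Finsupp.single (0, 0, 0) 1 + Finsupp.single (1, 0, 0) 1 + Finsupp.single (0, 1, 0) 1 +
      Finsupp.single (0, 0, 1) 1 + Finsupp.single (1, 1, 1) 2) = 0 := by
    -- the unipotent shear `x₀ ↦ x₀ - x₁` (Borel, trivial character)
    set S : Matrix (Fin 2) (Fin 2) ℂ := !![1, -1; 0, 1] with hS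
    have hSb : S ∈ borel 2 := by
      refine ⟨fun i j hji => ?_, fun i => ?_⟩
      · fin_cases i <;> fin_cases j <;> simp [hS] at hji ⊢
      · fin_cases i <;> simp [hS]
    have hwc : ∀ s : Fin 3, weightChar (rectType 2 2 3 s) S = 1 := fun s => by
      simp [weightChar, Fin.prod_univ_two, hS]
    -- `f(U) = c_B`, `f(V) = -f(U)` for `V = (swap,swap,swap)·U`, `f(S³·V) = f(V)`, `S³·V = T(3,-1,-1,-1)`
    have hU := evalT_family_two hf 1 1 1 1
    have hV := evalT_actTensor_permMatrix_of_odd hodd hf σ hσm hsign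
      (fun a b c => ![![![(1 : ℂ), 1], ![1, 0]], ![![1, 0], ![0, 1]]] a b c)
    have hVe : actTensor (σ.permMatrix ℂ) (σ.permMatrix ℂ) (σ.permMatrix ℂ)
        (fun a b c => ![![![(1 : ℂ), 1], ![1, 0]], ![![1, 0], ![0, 1]]] a b c) =
        fun a b c => ![![![(1 : ℂ), 0], ![0, 1]], ![![0, 1], ![1, 1]]] a b c := by
      funext a b c
      rw [actTensor_permMatrix_apply]
      fin_cases a <;> fin_cases b <;> fin_cases c <;> simp [hσ]
    have hW := hf.2 S S S hSb hSb hSb (fun a b c => ![![![(1 : ℂ), 0], ![0, 1]], ![![0, 1], ![1, 1]]] a b c)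
    have hWe : actTensor S S S (fun a b c => ![![![(1 : ℂ), 0], ![0, 1]], ![![0, 1], ![1, 1]]] a b c) =
        fun a b c => ![![![(3 : ℂ), -1], ![-1, 0]], ![![-1, 0], ![0, 1]]] a b c := by
      funext a b c
      simp only [actTensor_apply, Fin.sum_univ_two, hS]
      fin_cases a <;> fin_cases b <;> fin_cases c <;> norm_num
    have hT := evalT_family_two hf 3 (-1) (-1) (-1)
    rw [hVe] at hV
    rw [hWe, hwc 0, hwc 1, hwc 2, one_mul, one_mul, one_mul, hT, hV, hU, hA] at hW
    linear_combination (-1 / 2 : ℂ) * hW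
  -- `f` vanishes on the family
  have hfam : ∀ p x y z : ℂ, evalT (fun a b c => ![![![p, z], ![y, 0]], ![![x, 0], ![0, 1]]] a b c) f = 0 := by
    intro p x y z
    rw [evalT_family_two hf, hA, hB]
    ring
  -- every tensor with `t₁₁₁ ≠ 0` is carried into the family by a Borel triple
  have hmain : ∀ t : Tensor ℂ 2, t 1 1 1 ≠ 0 → evalT t f = 0 := by
    intro t ht
    set A : Matrix (Fin 2) (Fin 2) ℂ := !![1, -(t 0 1 1) / t 1 1 1; 0, (t 1 1 1)⁻¹] with hAd
    set B : Matrix (Fin 2) (Fin 2) ℂ := !![1, -(t 1 0 1) / t 1 1 1; 0, 1] with hBd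
    set C : Matrix (Fin 2) (Fin 2) ℂ := !![1, -(t 1 1 0) / t 1 1 1; 0, 1] with hCd
    have hAb : A ∈ borel 2 := by
      refine ⟨fun i j hji => ?_, fun i => ?_⟩
      · fin_cases i <;> fin_cases j <;> simp [hAd] at hji ⊢
      · fin_cases i <;> simp [hAd, ht]
    have hBb : B ∈ borel 2 := by
      refine ⟨fun i j hji => ?_, fun i => ?_⟩
      · fin_cases i <;> fin_cases j <;> simp [hBd] at hji ⊢
      · fin_cases i <;> simp [hBd]
    have hCb : C ∈ borel 2 := by
      refine ⟨fun i j hji => ?_, fun i => ?_⟩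
      · fin_cases i <;> fin_cases j <;> simp [hCd] at hji ⊢
      · fin_cases i <;> simp [hCd]
    have key := hf.2 A B C hAb hBb hCb t
    have hform : actTensor A B C t = fun a b c =>
        ![![![actTensor A B C t 0 0 0, actTensor A B C t 0 0 1], ![actTensor A B C t 0 1 0, 0]],
          ![![actTensor A B C t 1 0 0, 0], ![0, 1]]] a b c := by
      funext a b c
      fin_cases a <;> fin_cases b <;> fin_cases c
      · simp
      · simp
      · simp
      · simp [actTensor_apply, Fin.sum_univ_two, hAd, hBd, hCd]
        field_simp
        ring
      · simp
      · simp [actTensor_apply, Fin.sum_univ_two, hAd, hBd, hCd]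
        field_simp
        ring
      · simp [actTensor_apply, Fin.sum_univ_two, hAd, hBd, hCd]
        field_simp
        ring
      · simp [actTensor_apply, Fin.sum_univ_two, hAd, hBd, hCd, ht]
    rw [hform, hfam] at key
    exact (mul_eq_zero.mp key.symm).resolve_left
      (mul_ne_zero (mul_ne_zero (weightChar_ne_zero _ hAb) (weightChar_ne_zero _ hBb)) (weightChar_ne_zero _ hCb))
  -- every tensor, by the line through `e₁₁₁`
  have hall : ∀ t : Tensor ℂ 2, evalT t f = 0 := by
    intro t
    obtain ⟨Q, hQ⟩ := exists_polynomial_evalT_line f t (fun a b c => if a = 1 ∧ b = 1 ∧ c = 1 then (1 : ℂ) else 0)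
    have hroot : ({-t 1 1 1}ᶜ : Set ℂ) ⊆ {u | Q.IsRoot u} := by
      intro u hu
      rw [Set.mem_compl_singleton_iff] at hu
      rw [Set.mem_setOf_eq, Polynomial.IsRoot.def, ← hQ]
      apply hmain
      simp only [Pi.add_apply, Pi.smul_apply, smul_eq_mul, and_self, if_true, mul_one]
      intro h
      exact hu (by linear_combination h)
    have hQ0 : Q = 0 :=
      Polynomial.eq_zero_of_infinite_isRoot Q (((Set.finite_singleton (-t 1 1 1)).infinite_compl).mono hroot)
    have h0 := hQ 0
    rwa [zero_smul, add_zero, hQ0, Polynomial.eval_zero] at h0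
  -- hence `f = 0`
  apply MvPolynomial.funext
  intro v
  have h := hall fun a b c => v (a, b, c)
  rw [evalT, MvPolynomial.aeval_eq_eval] at h
  rw [map_zero]
  simpa only [Prod.mk.eta] using h

/-- **Level 3 is empty at block format 2 for every ambient format `m ≥ 2`** (format independence, part L). [this node] -/
theorem three_mem_emptyLevels_two {m : ℕ} (hm : 2 ≤ m) : 3 ∈ emptyLevels m 2 :=
  (mem_emptyLevels_iff_self hm).mpr three_mem_emptyLevels_two_two

/-- **H19 at level 3, unconditional.**  At every format `m ≥ 2`, every level-`3` weight vector of the full type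
`((3^m))³` (degree `3m`) vanishes on all tensors of rank `≤ r` whenever `2r + 1 < 3m`:
`r_m(3) ≥ ⌈(3m-1)/2⌉` — `r₃(3) ≥ 4`, `r₄(3) ≥ 6`, `r₆(3) ≥ 9`, `r₈(3) ≥ 12`, `r₉(3) ≥ 13`. [this node] -/
theorem evalT_eq_zero_of_level_three {m : ℕ} (hm : 2 ≤ m) {f : MvPolynomial (Idx m) ℂ}
    (hf : f ∈ hwvSpace (rectType m m 3) (3 * m)) {r : ℕ} (hr : 2 * r + 1 < 3 * m) {t : Tensor ℂ m}
    (ht : tensorRank t ≤ r) : evalT t f = 0 :=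
  evalT_eq_zero_of_emptyLevel_two_two_level_three three_mem_emptyLevels_two_two hm hf hr ht

/-- The same in level language: `3 ∉ E′_m(t)` for `R(t) ≤ r`, `2r + 1 < 3m`. [this node] -/
theorem three_not_mem_pointLevels {m : ℕ} (hm : 2 ≤ m) {r : ℕ} (hr : 2 * r + 1 < 3 * m) {t : Tensor ℂ m}
    (ht : tensorRank t ≤ r) : 3 ∉ pointLevels m t :=
  not_mem_pointLevels_of_emptyLevel_two_two three_mem_emptyLevels_two_two hm
    (by show (3 - 1) * (r - 1) < 3 * (m - 1); omega) ht

end LevelThreeFormatTwo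

end Summit.MatrixMultiplication.MatrixMultiplication.Theorems.ObstructionCalculus

end
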